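import Summits.BirchSwinnertonDyer.BirchSwinnertonDyer.Theorems.Rank2ObservatoryRank3Tors01
import Summits.BirchSwinnertonDyer.BirchSwinnertonDyer.Theorems.Rank2ObservatoryRank3Tors02
import Summits.BirchSwinnertonDyer.BirchSwinnertonDyer.Theorems.Rank2ObservatoryRank3Tors03
import Summits.BirchSwinnertonDyer.BirchSwinnertonDyer.Theorems.Rank2ObservatoryRank3Tors04
import Summits.BirchSwinnertonDyer.BirchSwinnertonDyer.Theorems.Rank2ObservatoryRank3Tors05
import Summits.BirchSwinnertonDyer.BirchSwinnertonDyer.Theorems.Rank2ObservatoryRank3Tors06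
import Summits.BirchSwinnertonDyer.BirchSwinnertonDyer.Theorems.Rank2ObservatoryRank3Tors07
import Summits.BirchSwinnertonDyer.BirchSwinnertonDyer.Theorems.Rank2ObservatoryRank3Tors08
import Summits.BirchSwinnertonDyer.BirchSwinnertonDyer.Theorems.Rank2ObservatoryRank3Tors09
import Summits.BirchSwinnertonDyer.BirchSwinnertonDyer.Theorems.Rank2ObservatoryRank3Tors10
import Summits.BirchSwinnertonDyer.BirchSwinnertonDyer.Theorems.Rank2ObservatoryRank3Tors11
import Summits.BirchSwinnertonDyer.BirchSwinnertonDyer.Theorems.Rank2ObservatoryRank3Tors12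
import Summits.BirchSwinnertonDyer.BirchSwinnertonDyer.Theorems.Rank2ObservatoryRank3Tors13
import Summits.BirchSwinnertonDyer.BirchSwinnertonDyer.Theorems.Rank2ObservatoryRank3Tors14
import Summits.BirchSwinnertonDyer.BirchSwinnertonDyer.Theorems.Rank2ObservatoryRank3Tors15
import Summits.BirchSwinnertonDyer.BirchSwinnertonDyer.Theorems.Rank2ObservatoryRank3Tors16
import Summits.BirchSwinnertonDyer.BirchSwinnertonDyer.Theorems.Rank2ObservatoryRank3Tors17
import Summits.BirchSwinnertonDyer.BirchSwinnertonDyer.Theorems.Rank2ObservatoryRank3Tors18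
import Summits.BirchSwinnertonDyer.BirchSwinnertonDyer.Theorems.Rank2ObservatoryRank3Tors19
import Summits.BirchSwinnertonDyer.BirchSwinnertonDyer.Theorems.Rank2ObservatoryRank3Tors20
import Summits.BirchSwinnertonDyer.BirchSwinnertonDyer.Theorems.Rank2ObservatoryRank3Tors21
import Summits.BirchSwinnertonDyer.BirchSwinnertonDyer.Theorems.Rank2ObservatoryRank3Tors22
import Summits.BirchSwinnertonDyer.BirchSwinnertonDyer.Theorems.Rank2ObservatoryRank3Tors23
import Summits.BirchSwinnertonDyer.BirchSwinnertonDyer.Theorems.Rank2ObservatoryRank3Tors24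
import Summits.BirchSwinnertonDyer.BirchSwinnertonDyer.Theorems.Rank2ObservatoryRank3Tors25
import Summits.BirchSwinnertonDyer.BirchSwinnertonDyer.Theorems.Rank2ObservatoryRank3Tors26
import Summits.BirchSwinnertonDyer.BirchSwinnertonDyer.Theorems.Rank2ObservatoryRank3Tors27
import Summits.BirchSwinnertonDyer.BirchSwinnertonDyer.Theorems.Rank2ObservatoryRank3Census
import HarnessLib

/-!
# BirchSwinnertonDyer — rank ≥ 2 observatory: KERNEL TORSION CENSUS of the rank-3 table

HONEST FRAMING: per-curve certified theorems and census instruments; no claim on BSD in rank ≥ 2.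
This file proves nothing about `L`-functions or ranks.

**What is certified here.** For every one of the `9487` curves `E` of the rank-3 census table
`rank3Table` (all curves of rank `3` and conductor `< 500 000` in Cremona's table — the completeness of
that list is DATA, see `Rank2ObservatoryRank3Census`), the BSD-formula invariant `#E(ℚ)_tors`
(Literature's `WeierstrassCurve.torsionOrder`) is COMPUTED IN THE KERNEL: the 27 data chunks
`Rank2ObservatoryRank3Tors01 … 27` pair each row with a torsion certificate (`TorsCert`,
`Rank2ObservatoryTorsionCert`) checked by `decide +kernel`, and the soundness theorem
`torsionOrder_of_check` turns a checked certificate into the value of `#E(ℚ)_tors`.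

* `rank3TorsCerts_zipAllB` — the whole table is a checked pairing (assembled from the chunk theorems);
* `torsionOrder_of_mem_zip` — every row's curve has the torsion order of its certificate;
* `rank3Table_torsionOrders` — the LIST of torsion orders of the table is the list of certificate orders;
* `rank3Table_torsionOrder_count` — the **census histogram** (kernel count):
  `#E(ℚ)_tors = 1, 2, 3, 4` for `8485, 959, 16, 27` curves, and nothing else occurs
  (`torsionOrder_mem_of_mem`); among the `27` curves with `#E(ℚ)_tors = 4`, `7` have a rational
  torsion point `τ` with `2 • τ ≠ 0` (so `E(ℚ)_tors ≅ ℤ/4`) and `20` have exponent `2`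
  (`E(ℚ)_tors ≅ ℤ/2 × ℤ/2`): `rank3Table_exists_order_four`, `rank3Table_exponent_two`, with the
  counts in `rank3TorsCerts_count`.

**Two implementations** (cell rule): engine 1 = a literal Python port of `TorsCert.check` plus the
certificate search (`certs.py`: 9487/9487 certified, agreeing with the torsion column of Cremona's
`allcurves` 9487/9487); engine 2 = PARI/GP `elltors` (Doud's algorithm — a different method), `ellap` at
every killer prime and `nfroots` on the division polynomials (kit job recorded in the cell's `JOBS.md`);
the kernel computation of this file is the certified instance.  By Mazur's theorem the a-priori possible
orders are `1, …, 10, 12, 16`; that only `1, 2, 3, 4` occur is an OBSERVATION about these 9487 curves,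
not a claim about rank-3 curves in general.

References: J. H. Silverman, *The Arithmetic of Elliptic Curves* (2nd ed. 2009), VII.3.1(b), VII.3.4,
III.2.3; J. E. Cremona, *Algorithms for Modular Elliptic Curves* (2nd ed. 1997), §3.3, §3.5 and tables.
-/

-- single-conjunct summit: `Summit.BirchSwinnertonDyer.BirchSwinnertonDyer.…` repeats the name by design
set_option linter.dupNamespace false

namespace Summit.BirchSwinnertonDyer.BirchSwinnertonDyer.Rank2Observatory

open WeierstrassCurve

/-- All `9487` torsion certificates of the rank-3 table, chunk by chunk, bracketed like `rank3Table`
(DATA). [cite: CremonaAlgorithms1997, Tables] -/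
def rank3TorsCerts : List TorsCert :=
  rank3Tors01 ++ rank3Tors02 ++ rank3Tors03 ++ rank3Tors04 ++ rank3Tors05 ++ rank3Tors06 ++
    rank3Tors07 ++ rank3Tors08 ++ rank3Tors09 ++ rank3Tors10 ++ rank3Tors11 ++ rank3Tors12 ++
    rank3Tors13 ++ rank3Tors14 ++ rank3Tors15 ++ rank3Tors16 ++ rank3Tors17 ++ rank3Tors18 ++
    rank3Tors19 ++ rank3Tors20 ++ rank3Tors21 ++ rank3Tors22 ++ rank3Tors23 ++ rank3Tors24 ++
    rank3Tors25 ++ rank3Tors26 ++ rank3Tors27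

/-- **The whole rank-3 table is a checked pairing** of its rows with torsion certificates (the 27
chunk theorems glued by `zipAllB_append` along the bracketing of `rank3Table`).
[cite: SilvermanAEC2009, Prop. VII.3.1(b)] -/
theorem rank3TorsCerts_zipAllB : zipAllB torsRowCheck rank3Table rank3TorsCerts = true := by
  unfold rank3Table rank3TorsCerts
  exact
    zipAllB_append (zipAllB_append (zipAllB_append (zipAllB_append (zipAllB_append (
      zipAllB_append (zipAllB_append (zipAllB_append (zipAllB_append (zipAllB_append (
      zipAllB_append (zipAllB_append (zipAllB_append (zipAllB_append (zipAllB_append (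
      zipAllB_append (zipAllB_append (zipAllB_append (zipAllB_append (zipAllB_append (
      zipAllB_append (zipAllB_append (zipAllB_append (zipAllB_append (zipAllB_append (
      zipAllB_append rank3Tors01_zipAllB rank3Tors02_zipAllB) rank3Tors03_zipAllB)
      rank3Tors04_zipAllB) rank3Tors05_zipAllB) rank3Tors06_zipAllB) rank3Tors07_zipAllB)
      rank3Tors08_zipAllB) rank3Tors09_zipAllB) rank3Tors10_zipAllB) rank3Tors11_zipAllB)
      rank3Tors12_zipAllB) rank3Tors13_zipAllB) rank3Tors14_zipAllB) rank3Tors15_zipAllB)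
      rank3Tors16_zipAllB) rank3Tors17_zipAllB) rank3Tors18_zipAllB) rank3Tors19_zipAllB)
      rank3Tors20_zipAllB) rank3Tors21_zipAllB) rank3Tors22_zipAllB) rank3Tors23_zipAllB)
      rank3Tors24_zipAllB) rank3Tors25_zipAllB) rank3Tors26_zipAllB) rank3Tors27_zipAllB

/-- **KERNEL TORSION CENSUS (per curve)**: every curve of the rank-3 table has the torsion order
`#E(ℚ)_tors` recorded by its certificate. HONEST FRAMING: per-curve certified theorems and census
instruments; no claim on BSD in rank ≥ 2. [cite: SilvermanAEC2009, Prop. VII.3.1(b)] -/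
theorem torsionOrder_of_mem_zip :
    ∀ p ∈ rank3Table.zip rank3TorsCerts, p.1.curve.torsionOrder = p.2.order :=
  torsionOrder_of_zipAllB rank3TorsCerts_zipAllB

/-- The list of torsion orders `#E(ℚ)_tors` of the 9487 curves of the rank-3 table IS the list of
certificate orders. [cite: SilvermanAEC2009, Prop. VII.3.1(b)] -/
theorem rank3Table_torsionOrders :
    rank3Table.map (fun r => r.curve.torsionOrder) = rank3TorsCerts.map TorsCert.order :=
  map_torsionOrder_of_zipAllB rank3TorsCerts_zipAllB

/-- Kernel count over the certificate list: orders `1, 2, 3, 4` occur `8485, 959, 16, 27` times, every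
certificate order lies in `[1, 2, 3, 4]`, kinds `ℤ/4` / `ℤ/2 × ℤ/2` occur `7` / `20` times, and there are
`9487` certificates. [cite: CremonaAlgorithms1997, Tables] -/
theorem rank3TorsCerts_count :
    (rank3TorsCerts.map TorsCert.order).count 1 = 8485 ∧
      (rank3TorsCerts.map TorsCert.order).count 2 = 959 ∧
      (rank3TorsCerts.map TorsCert.order).count 3 = 16 ∧
      (rank3TorsCerts.map TorsCert.order).count 4 = 27 ∧
      rank3TorsCerts.all (fun c => decide (c.order ∈ [1, 2, 3, 4])) = true ∧
      (rank3TorsCerts.map TorsCert.kind).count 4 = 7 ∧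
      (rank3TorsCerts.map TorsCert.kind).count 22 = 20 ∧ rank3TorsCerts.length = 9487 := by
  decide +kernel

/-- **THE CENSUS HISTOGRAM of `#E(ℚ)_tors` over the rank-3 table** (kernel): among the `9487` curves of
rank `3` and conductor `< 500 000`, `#E(ℚ)_tors = 1` for `8485`, `= 2` for `959`, `= 3` for `16` and
`= 4` for `27` curves. HONEST FRAMING: per-curve certified theorems and census instruments; no claim on
BSD in rank ≥ 2. [cite: SilvermanAEC2009, Prop. VII.3.1(b)] [cite: CremonaAlgorithms1997, Tables] -/
theorem rank3Table_torsionOrder_count :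
    (rank3Table.map (fun r => r.curve.torsionOrder)).count 1 = 8485 ∧
      (rank3Table.map (fun r => r.curve.torsionOrder)).count 2 = 959 ∧
      (rank3Table.map (fun r => r.curve.torsionOrder)).count 3 = 16 ∧
      (rank3Table.map (fun r => r.curve.torsionOrder)).count 4 = 27 := by
  rw [rank3Table_torsionOrders]
  obtain ⟨h1, h2, h3, h4, -, -⟩ := rank3TorsCerts_count
  exact ⟨h1, h2, h3, h4⟩

/-- Every curve of the rank-3 table has `#E(ℚ)_tors ∈ {1, 2, 3, 4}` (an observation about this table;
Mazur's theorem would allow `1 … 10, 12, 16`). [cite: SilvermanAEC2009, Prop. VII.3.1(b)] -/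
theorem torsionOrder_mem_of_mem {r : Rank3Row} (hr : r ∈ rank3Table) :
    r.curve.torsionOrder ∈ [1, 2, 3, 4] := by
  rw [← map_fst_of_zipAllB rank3TorsCerts_zipAllB] at hr
  obtain ⟨p, hp, rfl⟩ := List.mem_map.mp hr
  rw [torsionOrder_of_mem_zip p hp]
  obtain ⟨-, -, -, -, hall, -⟩ := rank3TorsCerts_count
  simpa using List.all_eq_true.mp hall p.2 (List.of_mem_zip hp).2

/-- **Exponent-2 rows**: for the rows certified with a `ℤ/2` or `ℤ/2 × ℤ/2` certificate (kinds `2`,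
`22`; `959 + 20` curves), every rational torsion point `τ` satisfies `2 • τ = 0`.
[cite: SilvermanAEC2009, Prop. VII.3.1(b)] -/
theorem rank3Table_exponent_two :
    ∀ p ∈ rank3Table.zip rank3TorsCerts, (p.2.kind = 2 ∨ p.2.kind = 22) →
      ∀ τ : p.1.curve.toAffine.Point, IsOfFinAddOrder τ → 2 • τ = 0 :=
  two_nsmul_torsion_of_zipAllB rank3TorsCerts_zipAllB

/-- **Order-4-element rows**: for the `7` rows certified with a `ℤ/4` certificate (kind `4`) there is a
rational torsion point `τ` with `2 • τ ≠ 0`; with `#E(ℚ)_tors = 4` this makes `E(ℚ)_tors` cyclic.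
[cite: SilvermanAEC2009, Prop. VII.3.1(b)] -/
theorem rank3Table_exists_order_four :
    ∀ p ∈ rank3Table.zip rank3TorsCerts, p.2.kind = 4 →
      ∃ τ : p.1.curve.toAffine.Point, IsOfFinAddOrder τ ∧ 2 • τ ≠ 0 :=
  exists_order_four_of_zipAllB rank3TorsCerts_zipAllB

end Summit.BirchSwinnertonDyer.BirchSwinnertonDyer.Rank2Observatory
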